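import Mathlib.Tactic.Ring
import Mathlib.Tactic.LinearCombination
import Mathlib.Tactic.Linarith
import Mathlib.Tactic.Positivity
import Mathlib.Tactic.FinCases
import Mathlib.Algebra.Order.Ring.Basic
import Mathlib.Data.Fin.Tuple.Sort
import Mathlib.Algebra.BigOperators.Fin
import Mathlib.Data.Real.Basic
import Mathlib.LinearAlgebra.Matrix.Adjugate
import HarnessLib

/-!
# The CLASS TEST kills every split design at a tensor point: `e₃` of `N`-positive divisor classes is never a
# charged Fermat cubic (Gårding hyperbolicity), with kernel-checked cores in ranks 3 and 4

Family `hodge`, layer `Literature/AlgebraicGeometry/HodgeTheory`. Fully PROVED statements (no named fact, no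
definition): census ALGEBRA for the Bloch-seed hunt of the ladder note `papers/HodgeConjecture/hodge-weil-ladder`
(packet `run/shared/lean/b2b/hodge-weil/`, prover 2 generation 6, note `b2b-hweil-pv2-g6/SEED-K3.md`), in the
standard of `BlochSeedRankTwoWindow.lean` / `BlochSeedZeroLocusEuler.lean`: the geometry is the dictionary below, the
kernel checks the algebra. It decides NEGATIVELY, at every tensor point with generic Néron–Severi group, the CLASS TEST
(LADDER `## CARVER v7` C47/C48, step (1) of the seed pipeline) for the whole species "zero or degeneracy locus of a direct
sum of line bundles with sections (or of a bundle filtered by such line bundles), any rank" — the only species for which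
the later steps (coherent cohomology of `N_Z`, Bloch's map) reduce to line-bundle cohomology. It is NOT a case of the
Hodge conjecture and closes no rung.

## Dictionary (pen-and-paper inputs; each line is a standard theorem or a kernel fact of the tree, named)

* (T) TENSOR POINT. `A₀` a complex abelian threefold with `End(A₀) = ℤ` (Hodge group `Sp₆`: a very general p.p.a.v. or a
  very general Jacobian of genus 3), `Y₀ := A₀ × A₀ = A₀ ⊗ ℤ²`, `K = ℚ(√-d)` acting by `J(x,y) = (−dy, x)` — the tensor
  points of the design input `HasTensorBlochSeeds 3 d` of door T∘S (`WeilClassesTensorBlochSeed.lean`,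
  `Theorems/WeilTypeLadderTensorBlochSeed.lean`), whose Weil plane is algebraic (`WeilClassesTensorPointAlgebraic.lean`).
  `NS(Y₀)_ℚ = ℚθ₁ ⊕ ℚθ₂ ⊕ ℚP` (`θ_i = pr_i^*θ`, `P` the Poincaré class; rank 3 because `End(A₀) = ℤ`), with the
  `ℂ`-basis `N := θ₁ + dθ₂` (the `K`-compatible polarization, `J^*N = d·N`, charge 0), `L := θ₁ − dθ₂ + λP`
  (`λ = i√d`, `J^*L = −d·L`, charge 2) and `L̄`; a RATIONAL class is `αN + βL + β̄L̄` with `α ∈ ℚ`, `β ∈ K`.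
  `B³ :=` Hodge classes in `H⁶(Y₀, ℚ)` `= Sp(H¹A₀)`-invariants, `dim B³ = 10`, and cup product
  `Sym³ NS_ℚ → B³` is an ISOMORPHISM (first fundamental theorem for `Sp₆`: the invariants are generated in degree 2, so
  the map is onto; `dim Sym³(ℚ³) = 10`; exact rank check for `d ∈ {1,3,7}` in `b2b-hweil-pv2-g4/tensor_point_cubic.py`):
  every Hodge class of degree 6 on `Y₀` is a UNIQUE cubic form `F(N, L, L̄)`, i.e. `N, L, L̄` may be treated as
  algebraically independent — which is what makes the coefficient comparisons below legitimate
  (`b2b-hweil-pv2-g4/BLOCH-SEEDS.md` §3 (i)–(iii); found independently as §4 H2 of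
  `Cruxes/WeilSixfoldsSqrtMinus7/Lines/semiregular-clean-lci-six-stub2-c12.md`).
* (W) The Weil plane is `W ⊗ ℂ = ℂL³ ⊕ ℂL̄³` (`L³ = 6·w_σ`, ibid. §3 (iii)); the classes of `H⁶(Y₀)` that stay Hodge
  along the Weil family through `(Y₀, J, N)` (special Mumford–Tate group `SU(3,3)`) are `ℚN³ ⊕ W`; `N ∪ W = 0`
  (tree: `cupProduct_eq_zero_of_map_eq_smul_of_mem_weilClassesOf`).
* (P) PURITY. For an INTEGRAL `Z ⊂ Y₀` of codimension 3, `H⁶_Z(Y₀; ℚ) = ℚ·[Z]`, so "`q·N³ + w` is supported on `Z`"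
  (the clause `classesSupportedOn` of `HasBlochSeedAt`, `WeilClassesBlochSeed.lean`) forces `[Z] ∝ q·N³ + w` EXACTLY;
  a Bloch seed for a non-zero Weil class therefore needs `[Z] = qN³ + aL³ + āL̄³` with `a ≠ 0`, and `q > 0` because
  `∫_Z N³ = q·∫N⁶ > 0`. In coordinates: the seven MIXED coefficients of `F = [Z]` — those of
  `N²L, N²L̄, NL², NL̄², NLL̄, L²L̄, LL̄²` — vanish (the CLASS TEST), `[N³] = q`, `[L³] = a`.
* (S) SPLIT DESIGNS. `E = ⊕_{i=1}^e L_i`, or any bundle with a filtration whose graded pieces are the `L_i` (same Chern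
  classes), `l_i := c₁(L_i) = α_iN + β_iL + β̄_iL̄`. The zero scheme of a regular section (`e = 3`) and the degeneracy
  locus `D_{e−3}(σ)` of `e − 2` general sections (`e ≥ 3`; Thom–Porteous) both have class `c₃(E) = e₃(l₁, …, l_e)`,
  the third elementary symmetric polynomial [cite: Fulton1998, §14.4 Thm 14.4]. Sections force `L_i` effective, hence
  nef; for a nef class `l = αN + βL + β̄L̄` one has `α = (l·N⁵)/(N⁶) ≥ 0` (`L·N⁵ = 0` by charge), with `α = 0` only for
  `l = 0` (a non-zero positive-semidefinite Hermitian form has positive mixed volume with a definite one); ample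
  `⟺ α > 2|β|` (the rank-one classes `π_m^*θ = ¼(2|z|²N + z²L + z̄²L̄)`, `z = m₁ + m₂/λ`, bound the cone).
  Summands with `l_i = 0` do not change `e₃`; so WLOG `α_i > 0` for all `i`.
* (G) THEOREM (paper, every rank `e ≥ 3`). If `α_i > 0` for all `i`, then `e₃(l₁, …, l_e) ≠ qN³ + aL³ + āL̄³` for every
  `a ≠ 0`. PROOF. Fix `z ∈ ℂ` and apply the ring homomorphism `ℂ[N, L, L̄] → ℂ[t]`, `N ↦ t`, `L ↦ z`, `L̄ ↦ z̄`:
  `l_i ↦ α_i t + γ_i` with `γ_i := 2 Re(β_i z) ∈ ℝ`, and the class test gives `e₃(γ + tα) = e₃(α)·t³ + 2 Re(a z³)` (the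
  `t²`- and `t`-coefficients are `z[N²L] + z̄[N²L̄]` and `z²[NL²] + |z|²[NLL̄] + z̄²[NL̄²]`, both zero). The elementary
  symmetric polynomial `e₃` is hyperbolic with respect to every vector of the open positive orthant
  [cite: Branden2013, §1 p.3] [cite: Garding1959, Thm 2] (equivalently: `e₃` is real stable, line criterion
  [cite: Branden2007, §3 after Rem. 3.5]), so `t ↦ e₃(γ + tα)` has three real roots; `e₃(α)t³ + c` with `c ≠ 0` has one.
  Hence `Re(a z³) = 0` for all `z`, i.e. `a = 0`. ∎  Rank 3 needs no positivity: `qN³ + aL³ + āL̄³` with `qa ≠ 0` has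
  no linear factor at all (§1), while `c₃` of a rank-3 split or filtered bundle is `l₁l₂l₃`; this also covers every class
  that is a product of three complex divisor classes (complete intersections; `Θ × C ⊂ A₀ × A₀` moved by an isogeny,
  class `½θ_vθ_{v'}²`; Pontryagin products of three curve classes, which form `Sym³` of the same 3-space) — the "Fermat
  cubic" remark of `BLOCH-SEEDS.md` §3 (iii), here kernel-checked over any field of characteristic `≠ 3`.
* (D) DETERMINANTAL SPLIT DESIGNS (the other format with line-bundle cohomology). `φ : F → E`, `rk F = k+1`,
  `rk E = k+3`, `E, F` sums of line bundles with `Hom(F, E)` ample (every `l_i − m_j` ample), `Z = D_k(φ)` (smooth of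
  codimension 3 for general `φ`, `Sing ⊂ D_{k−1} = ∅`), `[Z] = c₃(E − F)` [cite: Fulton1998, §14.4]. For `k = 0` this is
  `e₃(l_i − m)`, covered by (G). For `k = 1`, `c₃(E − F) = (∏ᵢ(lᵢ − m₁) − ∏ᵢ(lᵢ − m₂))/(m₂ − m₁)` (§6, a divided
  difference; twist-invariant as it must be) is NOT hyperbolic, and (G) does not apply; NUMERICS of this seat
  (`b2b-hweil-pv2-g6/SEED-K3.md` §3: multistart Levenberg–Marquardt and SLSQP, kit job recorded there) find NO pure
  charged solution with all `l_i − m_j` ample for `(k+3, k+1) = (4,2), (5,3)` — constrained minimizers run to the boundary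
  of the ample cone with `|a| → 0` — while the same code finds exact solutions as soon as two of the eight ampleness
  constraints are dropped. Recorded as a NUMERICAL no-go (census), not as a theorem.
* (C) CONSEQUENCE for the ladder (LADDER C45/C48). `HasTensorBlochSeeds 3 d` asks for seeds at EVERY tensor sixfold, in
  particular at those with `NS = NS_gen` of rank 3: there no zero or degeneracy locus of a split or nef-filtered bundle of
  any rank passes the class test (theorem), and no determinantal locus of a map between split bundles with ample
  Hom-bundle does numerically. PRECISION: at such a point `ℚN` is the only `K`-compatible direction and `(A₀ ⊗ O_K, J, N)`
  is SPLIT (`Λ ⊗ K`, `Λ` a rational Lagrangian of `E_θ`, is isotropic of dimension 3 for the Hermitian form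
  `√-d·E_θ(v, w̄)`); so the theorem bears on the predicate AS TYPED and on door-S calibration of the split floor, while
  the anchors of the NON-split rungs (tensor points with `NS ⊋ NS_gen`, up to the CM point) are constrained only in
  their `NS_gen`-designs (§7: cubes from all of `NS` at the CM point). Together with the census of `BLOCH-SEEDS.md` §4 (sub-tori, galleries, complete
  intersections, products of curves) this leaves, at generic tensor points, only bundles whose Chern polynomial does NOT
  split into `N`-positive real classes — kernels / cokernels of maps whose Hom-bundle is not nef, elementary
  modifications, Markman-type secant sheaves — for which `H¹(Z, N_Z)` is no longer line-bundle cohomology. At the CM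
  anchor `(E_K³)²` of door C∘S (`NS` of rank 36 ⊋ NS_gen) the theorem constrains only designs drawn from `NS_gen`; the
  Hermitian-triple numerics of the crux dossier (kit j022298 / j023470) cover rank 3 in all of `NS` there.

## What is proved here (algebra only)

§1 `fermatCubic_no_linear_factor`: over any field with `3 ≠ 0`, `qX³ + aY³ + bZ³` (`qab ≠ 0`) is not `ℓ·Q` with `ℓ`
linear, `Q` quadratic (eight of the ten coefficient identities already contradict). §2
`shiftedCubic_constCoeff_eq_zero_sorted`: for reals `μ₁ ≤ μ₂ ≤ μ₃ ≤ μ₄` and weights `w_k > 0`, if the cubic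
`f(t) = Σ_k w_k ∏_{j≠k}(t + μ_j)` has vanishing `t²`- and `t`-coefficients then its constant coefficient vanishes
(elementary: `f(−μ₂) ≤ 0 ≤ f(−μ₃)` against monotonicity of `At³ + D`, then the derivative at the double root) — the
rank-4 instance of Gårding's real-rootedness, proved from scratch. §3 `shiftedCubic_constCoeff_eq_zero`: the same
without the ordering (power-sum form, `Tuple.sort`). §4 `e3_eq_zero_of_adjacent_coeffs`: for `α_i > 0`,
`Σ_j γ_j e₂(α_{≠j}) = 0` and `Σ_j α_j e₂(γ_{≠j}) = 0` force `e₃(γ) = 0` (§3 with `μ_k = γ_k∏_{j≠k}α_j`,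
`w_k = ∏_{j≠k}α_j`, division-free). §5 `splitRankFour_classTest_uncharged`: THE RANK-4 CLASS TEST — with
`β_j = u_j + i v_j`, the purity conditions `[N²L] = 0` (2 real equations), `Re[NL²] = 0`, `[NLL̄] = 0`, `[L²L̄] = 0`
(2 real equations) and `α_j > 0` force `a = [L³] = e₃(β) = 0` (real part `E_uuu − E_uvv`, imaginary part
`E_uuv − E_vvv`); `Im[NL²] = 0` is not even needed. §6 `detClass_four_two_dividedDifference`: the `(4,2)` determinantal
class times `m` is `∏(X_i + m) − ∏ X_i` (ring identity; the object of (D)). §7 (appendix, the CM anchor, CUBES only)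
`columns_eq_zero_of_mixed_minors`, `cmCube_classTest_uncharged`: at `Y₀ = E_ι³ × E_ῑ³` with ANY `K`-compatible `θ`
(block-diagonal, DICTIONARY (M) below) no complex `(1,1)`-class `x` has `x³` pure and charged — Cramer's rule on the
`3 × 3` blocks of `x` (the by-hand remark "single cube impossible" of the crux dossier §4 H2, kernel-checked).

* (M) CM ANCHOR, CUBES (used only in §7). `Y₀ = A × A'`, `A = E_ι³`, `A' = E_ῑ³`; holomorphic covectors `e_1..e_3`
  (from `A`), `e_4..e_6` (from `A'`), antiholomorphic `ē_b`. A complex `(1,1)`-class is `x = Σ X_{ab} e_a ∧ ē_b`, a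
  `6 × 6` matrix `X = [[A, B], [C, D]]` in `3 × 3` blocks; `x³ = ±6 Σ_{|I|=|J|=3} det(X_{IJ}) e_I ∧ ē_J`. The charge of
  `e_a ∧ ē_b` is `0` on the diagonal blocks and `±2` off them, so a `K`-compatible `θ` (`Ψ^*θ = dθ`, charge 0) is
  BLOCK-DIAGONAL `T = diag(T₁, T₂)` with `T₁, T₂` non-degenerate (`θ = θ_A ⊞ θ_{A'}`), and the Weil lines are
  `w_σ = e_{123} ∧ ē_{456}`, `w̄_σ = e_{456} ∧ ē_{123}` (`∧⁶V_σ`, `V_σ = H^{1,0}(A) ⊕ H^{0,1}(A')`). Purity of `x³`,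
  `x³ = qθ³ + a w_σ + a' w̄_σ`, reads: `det X_{IJ} = q·det T_{IJ}` for every `(I,J) ∉ {(123,456), (456,123)}`, and
  `det B = det X_{123,456} ∝ a`. Since `T` is block-diagonal, `det T_{123, J} = 0` for `J = {j, k', l'}` (one column
  index `≤ 3`, two `≥ 4`), i.e. `det[A_{·j} | B_{·k'} | B_{·l'}] = 0` for all `j` and `k' < l'` — in Cramer form: every
  column of `A`, substituted for any column of `B`, kills the determinant — while `det A = det X_{123,123} = q det T₁`.
-/

namespace Literature.AlgebraicGeometry.HodgeTheory.WeilClassTestSplitDesigns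

/-! ### §1 Rank 3 and every product of three divisor classes: the Fermat cubic has no linear factor -/

/-- **The charged Fermat cubic has no linear factor.** Over a field with `3 ≠ 0`, there are no linear form
`ℓ = l₁X + l₂Y + l₃Z` and quadratic form `Q = Qxx X² + Qyy Y² + Qzz Z² + Qxy XY + Qxz XZ + Qyz YZ` with
`ℓ·Q = qX³ + aY³ + bZ³` when `q, a, b ≠ 0`: already the coefficient identities at
`X³, Y³, Z³, X²Y, X²Z, XY², Y²Z, XYZ` (eight of ten) are contradictory, since they give `3·l₁·l₂²·l₃·Qxx = 0` with every
factor non-zero. DICTIONARY (T)(P)(G): with `X = N`, `Y = L`, `Z = L̄`, `b = ā`, a pure charged class is never a product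
of three (real or complex) divisor classes of `NS_gen ⊗ ℂ` — `c₃` of a rank-3 split / filtered bundle, a complete
intersection of three divisors, `Θ × C` moved by an isogeny, a Pontryagin product of three curve classes.
[cite: Fulton1998, §14.4 Thm 14.4] -/
theorem fermatCubic_no_linear_factor {K : Type*} [Field K] (h3 : (3 : K) ≠ 0)
    {q a b : K} (hq : q ≠ 0) (ha : a ≠ 0) (hb : b ≠ 0)
    (l₁ l₂ l₃ Qxx Qyy Qzz Qxy Qxz Qyz : K)
    (cX3 : l₁ * Qxx = q) (cY3 : l₂ * Qyy = a) (cZ3 : l₃ * Qzz = b)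
    (cX2Y : l₁ * Qxy + l₂ * Qxx = 0) (cX2Z : l₁ * Qxz + l₃ * Qxx = 0)
    (cXY2 : l₁ * Qyy + l₂ * Qxy = 0) (cY2Z : l₂ * Qyz + l₃ * Qyy = 0)
    (cXYZ : l₁ * Qyz + l₂ * Qxz + l₃ * Qxy = 0) : False := by
  have key : 3 * l₁ * l₂ ^ 2 * l₃ * Qxx = 0 := by
    linear_combination l₁ ^ 3 * cY2Z - l₁ ^ 2 * l₃ * cXY2 + 2 * l₁ * l₂ * l₃ * cX2Y
      + l₁ * l₂ ^ 2 * cX2Z - l₁ ^ 2 * l₂ * cXYZ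
  have hl₁ : l₁ ≠ 0 := by rintro rfl; exact hq (by rw [← cX3]; ring)
  have hQ : Qxx ≠ 0 := by rintro rfl; exact hq (by rw [← cX3]; ring)
  have hl₂ : l₂ ≠ 0 := by rintro rfl; exact ha (by rw [← cY3]; ring)
  have hl₃ : l₃ ≠ 0 := by rintro rfl; exact hb (by rw [← cZ3]; ring)
  have : 3 * l₁ * l₂ ^ 2 * l₃ * Qxx ≠ 0 :=
    mul_ne_zero (mul_ne_zero (mul_ne_zero (mul_ne_zero h3 hl₁) (pow_ne_zero 2 hl₂)) hl₃) hQ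
  exact this key

/-- Tightness of §1 in the charge-free direction: with `q = 0` the binary cubic DOES split off a linear factor,
`Y³ + Z³ = (Y + Z)(Y² − YZ + Z²)` — so the hypothesis `q ≠ 0` (DICTIONARY (P): `∫_Z N³ > 0` for an effective `Z`) is
what the argument uses; the three linear factors of `aL³ + āL̄³` are indefinite classes (`BLOCH-SEEDS.md` §3 (iii)).
[folklore] -/
theorem fermatCubic_chargeOnly_splits {R : Type*} [CommRing R] (Y Z : R) :
    Y ^ 3 + Z ^ 3 = (Y + Z) * (Y ^ 2 - Y * Z + Z ^ 2) := by
  ring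

/-! ### §2 Rank 4, sorted form: the shifted `e₃`-cubic with vanishing `t²`, `t` coefficients has vanishing constant term -/

/-- **Gårding for `e₃` in four variables, elementary and sorted.** Let `μ₁ ≤ μ₂ ≤ μ₃ ≤ μ₄` be real and `w₁, …, w₄ > 0`
(weight `w_k` on the triple omitting `k`), and let `f(t) = Σ_k w_k ∏_{j ≠ k} (t + μ_j) = A t³ + B t² + C t + D`,
`A = Σ w_k`. If `B = 0` (`h2`) and `C = 0` (`h1`) then `D = 0`. Proof: `f(−μ₂) = w₂(μ₁−μ₂)(μ₃−μ₂)(μ₄−μ₂) ≤ 0` and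
`f(−μ₃) = w₃(μ₁−μ₃)(μ₂−μ₃)(μ₄−μ₃) ≥ 0`, while `f = At³ + D` is increasing and `−μ₃ ≤ −μ₂`: both values vanish,
`μ₂ = μ₃ =: μ`, `D = Aμ³`; then `f'(−μ) = 3Aμ² = (w₂ + w₃)(μ₁ − μ)(μ₄ − μ) ≤ 0` gives `μ = 0`. (With `w_k = ∏_{j≠k} α_j`
and `μ_k = γ_k/α_k` this is the real-rootedness of `t ↦ e₃(γ + tα)` that (G) takes from Gårding's theorem.)
[cite: Garding1959, Thm 2] [cite: Branden2013, §1 p.3] -/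
theorem shiftedCubic_constCoeff_eq_zero_sorted (μ₁ μ₂ μ₃ μ₄ w₁ w₂ w₃ w₄ : ℝ)
    (hw₁ : 0 < w₁) (hw₂ : 0 < w₂) (hw₃ : 0 < w₃) (hw₄ : 0 < w₄)
    (h12 : μ₁ ≤ μ₂) (h23 : μ₂ ≤ μ₃) (h34 : μ₃ ≤ μ₄)
    (h2 : w₁ * (μ₂ + μ₃ + μ₄) + w₂ * (μ₁ + μ₃ + μ₄) + w₃ * (μ₁ + μ₂ + μ₄)
      + w₄ * (μ₁ + μ₂ + μ₃) = 0)
    (h1 : w₁ * (μ₂ * μ₃ + μ₂ * μ₄ + μ₃ * μ₄) + w₂ * (μ₁ * μ₃ + μ₁ * μ₄ + μ₃ * μ₄)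
      + w₃ * (μ₁ * μ₂ + μ₁ * μ₄ + μ₂ * μ₄) + w₄ * (μ₁ * μ₂ + μ₁ * μ₃ + μ₂ * μ₃) = 0) :
    w₁ * (μ₂ * μ₃ * μ₄) + w₂ * (μ₁ * μ₃ * μ₄) + w₃ * (μ₁ * μ₂ * μ₄)
      + w₄ * (μ₁ * μ₂ * μ₃) = 0 := by
  set A := w₁ + w₂ + w₃ + w₄ with hA_def
  set D := w₁ * (μ₂ * μ₃ * μ₄) + w₂ * (μ₁ * μ₃ * μ₄) + w₃ * (μ₁ * μ₂ * μ₄)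
      + w₄ * (μ₁ * μ₂ * μ₃) with hD_def
  have hA : 0 < A := by positivity
  -- the values `f(-μ₂)` and `f(-μ₃)` of `f(t) = A t³ + D`
  have e2 : D - A * μ₂ ^ 3 = w₂ * ((μ₁ - μ₂) * ((μ₃ - μ₂) * (μ₄ - μ₂))) := by
    linear_combination (-μ₂ ^ 2) * h2 + μ₂ * h1
  have e3 : D - A * μ₃ ^ 3 = w₃ * ((μ₁ - μ₃) * ((μ₂ - μ₃) * (μ₄ - μ₃))) := by
    linear_combination (-μ₃ ^ 2) * h2 + μ₃ * h1
  have s2 : (μ₁ - μ₂) * ((μ₃ - μ₂) * (μ₄ - μ₂)) ≤ 0 :=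
    mul_nonpos_of_nonpos_of_nonneg (by linarith) (mul_nonneg (by linarith) (by linarith))
  have s3 : 0 ≤ (μ₁ - μ₃) * ((μ₂ - μ₃) * (μ₄ - μ₃)) :=
    mul_nonneg_of_nonpos_of_nonpos (by linarith)
      (mul_nonpos_of_nonpos_of_nonneg (by linarith) (by linarith))
  have hD2 : D ≤ A * μ₂ ^ 3 := by nlinarith [mul_nonpos_of_nonpos_of_nonneg s2 hw₂.le]
  have hD3 : A * μ₃ ^ 3 ≤ D := by nlinarith [mul_nonneg s3 hw₃.le]
  have hcube : μ₃ ^ 3 ≤ μ₂ ^ 3 := le_of_mul_le_mul_left (hD3.trans hD2) hA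
  have h32 : μ₃ ≤ μ₂ := ((Odd.strictMono_pow (by decide : Odd 3)).le_iff_le).1 hcube
  have heq : μ₃ = μ₂ := le_antisymm h32 h23
  subst heq
  have hD : D = A * μ₃ ^ 3 := le_antisymm hD2 hD3
  -- the derivative at the double root `-μ₃`: `f'(-μ₃) = 3 A μ₃² = (w₂ + w₃)(μ₁ - μ₃)(μ₄ - μ₃) ≤ 0`
  have eder : 3 * A * μ₃ ^ 2 = (w₂ + w₃) * ((μ₁ - μ₃) * (μ₄ - μ₃)) := by
    linear_combination 2 * μ₃ * h2 - h1
  have sder : (μ₁ - μ₃) * (μ₄ - μ₃) ≤ 0 :=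
    mul_nonpos_of_nonpos_of_nonneg (by linarith) (by linarith)
  have hμsq : μ₃ ^ 2 ≤ 0 := by
    nlinarith [mul_nonpos_of_nonpos_of_nonneg sder (by linarith : (0:ℝ) ≤ w₂ + w₃)]
  have hμ : μ₃ = 0 := by nlinarith [sq_nonneg μ₃]
  rw [hD, hμ]; ring

/-! ### §3 Rank 4, symmetric form (the ordering removed by `Tuple.sort`) -/

/-- **§2 without the ordering hypothesis.** For `μ, w : Fin 4 → ℝ` with all `w k > 0`, write `S₀ = Σ w_k`,
`S_r = Σ w_k μ_kʳ`, `P_r = Σ μ_jʳ`, `e₂ = (P₁² − P₂)/2`, `e₃ = (P₁³ − 3P₁P₂ + 2P₃)/6` (Newton). The coefficients of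
`f(t) = Σ_k w_k ∏_{j≠k}(t + μ_j)` are `[t²] = S₀P₁ − S₁`, `[t] = S₀e₂ − S₁P₁ + S₂`, `[1] = S₀e₃ − S₁e₂ + S₂P₁ − S₃`
(from `e_r(μ_{≠k}) = e_r − μ_k e_{r−1}(μ_{≠k})`); if the first two vanish, so does the third. Proof: reindex all seven
sums by the sorting permutation of `μ` and apply the sorted lemma. [cite: Garding1959, Thm 2] -/
theorem shiftedCubic_constCoeff_eq_zero (μ w : Fin 4 → ℝ) (hw : ∀ k, 0 < w k)
    (h2 : (∑ k, w k) * (∑ j, μ j) - ∑ k, w k * μ k = 0)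
    (h1 : (∑ k, w k) * (((∑ j, μ j) ^ 2 - ∑ j, μ j ^ 2) / 2)
      - (∑ k, w k * μ k) * (∑ j, μ j) + ∑ k, w k * μ k ^ 2 = 0) :
    (∑ k, w k) * (((∑ j, μ j) ^ 3 - 3 * (∑ j, μ j) * (∑ j, μ j ^ 2) + 2 * ∑ j, μ j ^ 3) / 6)
      - (∑ k, w k * μ k) * (((∑ j, μ j) ^ 2 - ∑ j, μ j ^ 2) / 2)
      + (∑ k, w k * μ k ^ 2) * (∑ j, μ j) - ∑ k, w k * μ k ^ 3 = 0 := by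
  obtain ⟨σ, hσ⟩ : ∃ σ : Equiv.Perm (Fin 4), Monotone (μ ∘ σ) :=
    ⟨Tuple.sort μ, Tuple.monotone_sort μ⟩
  have eP1 : ∑ j, μ j = ∑ j, μ (σ j) := (Equiv.sum_comp σ μ).symm
  have eP2 : ∑ j, μ j ^ 2 = ∑ j, μ (σ j) ^ 2 := (Equiv.sum_comp σ (fun j => μ j ^ 2)).symm
  have eP3 : ∑ j, μ j ^ 3 = ∑ j, μ (σ j) ^ 3 := (Equiv.sum_comp σ (fun j => μ j ^ 3)).symm
  have eS0 : ∑ k, w k = ∑ k, w (σ k) := (Equiv.sum_comp σ w).symm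
  have eS1 : ∑ k, w k * μ k = ∑ k, w (σ k) * μ (σ k) :=
    (Equiv.sum_comp σ (fun k => w k * μ k)).symm
  have eS2 : ∑ k, w k * μ k ^ 2 = ∑ k, w (σ k) * μ (σ k) ^ 2 :=
    (Equiv.sum_comp σ (fun k => w k * μ k ^ 2)).symm
  have eS3 : ∑ k, w k * μ k ^ 3 = ∑ k, w (σ k) * μ (σ k) ^ 3 :=
    (Equiv.sum_comp σ (fun k => w k * μ k ^ 3)).symm
  rw [eP1, eP2, eS0, eS1, eS2] at h1
  rw [eP1, eS0, eS1] at h2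
  rw [eP1, eP2, eP3, eS0, eS1, eS2, eS3]
  simp only [Fin.sum_univ_four] at h1 h2 ⊢
  have m01 : μ (σ 0) ≤ μ (σ 1) := hσ (by decide)
  have m12 : μ (σ 1) ≤ μ (σ 2) := hσ (by decide)
  have m23 : μ (σ 2) ≤ μ (σ 3) := hσ (by decide)
  have key := shiftedCubic_constCoeff_eq_zero_sorted (μ (σ 0)) (μ (σ 1)) (μ (σ 2)) (μ (σ 3))
    (w (σ 0)) (w (σ 1)) (w (σ 2)) (w (σ 3)) (hw _) (hw _) (hw _) (hw _) m01 m12 m23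
    (by linear_combination h2) (by linear_combination h1)
  linear_combination key

/-! ### §4 Rank 4 in the `(α, γ)`-coordinates of the dictionary (division-free) -/

/-- **`e₃(γ + tα)` with `α > 0`: vanishing `t²`- and `t`-coefficients force a vanishing constant term.** For reals
`α₁, …, α₄ > 0` and `γ₁, …, γ₄`, the cubic `t ↦ e₃(γ₁ + tα₁, …, γ₄ + tα₄)` has coefficients `[t³] = e₃(α)`,
`[t²] = Σ_j γ_j e₂(α_{≠j})` (`h2`), `[t] = Σ_j α_j e₂(γ_{≠j})` (`h1`), `[1] = e₃(γ)`; if `[t²] = [t] = 0` then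
`e₃(γ) = 0`. Proof: §3 with `w_k = ∏_{j≠k} α_j` and `μ_k = γ_k ∏_{j≠k} α_j` (`= P·γ_k/α_k`, `P = α₁α₂α₃α₄`): its two
hypotheses are `P·h2` and `P²·h1`, its conclusion is `P³·e₃(γ) = 0`. In (G) this is applied with
`γ_j = 2 Re(β_j z)`. [cite: Garding1959, Thm 2] [cite: Branden2013, §1 p.3] -/
theorem e3_eq_zero_of_adjacent_coeffs (α₁ α₂ α₃ α₄ γ₁ γ₂ γ₃ γ₄ : ℝ)
    (hα₁ : 0 < α₁) (hα₂ : 0 < α₂) (hα₃ : 0 < α₃) (hα₄ : 0 < α₄)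
    (h2 : γ₁ * (α₂ * α₃ + α₂ * α₄ + α₃ * α₄) + γ₂ * (α₁ * α₃ + α₁ * α₄ + α₃ * α₄)
      + γ₃ * (α₁ * α₂ + α₁ * α₄ + α₂ * α₄) + γ₄ * (α₁ * α₂ + α₁ * α₃ + α₂ * α₃) = 0)
    (h1 : α₁ * (γ₂ * γ₃ + γ₂ * γ₄ + γ₃ * γ₄) + α₂ * (γ₁ * γ₃ + γ₁ * γ₄ + γ₃ * γ₄)
      + α₃ * (γ₁ * γ₂ + γ₁ * γ₄ + γ₂ * γ₄) + α₄ * (γ₁ * γ₂ + γ₁ * γ₃ + γ₂ * γ₃) = 0) :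
    γ₁ * γ₂ * γ₃ + γ₁ * γ₂ * γ₄ + γ₁ * γ₃ * γ₄ + γ₂ * γ₃ * γ₄ = 0 := by
  set P := α₁ * α₂ * α₃ * α₄ with hP
  have hP0 : P ≠ 0 := by positivity
  have key := shiftedCubic_constCoeff_eq_zero
    ![γ₁ * (α₂ * α₃ * α₄), γ₂ * (α₁ * α₃ * α₄), γ₃ * (α₁ * α₂ * α₄), γ₄ * (α₁ * α₂ * α₃)]
    ![α₂ * α₃ * α₄, α₁ * α₃ * α₄, α₁ * α₂ * α₄, α₁ * α₂ * α₃]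
    (by intro k; fin_cases k <;> simp <;> positivity)
    (by simp only [Fin.sum_univ_four, Matrix.cons_val]; linear_combination P * h2)
    (by simp only [Fin.sum_univ_four, Matrix.cons_val]; linear_combination P ^ 2 * h1)
  simp only [Fin.sum_univ_four, Matrix.cons_val] at key
  have hP3 : P ^ 3 * (γ₁ * γ₂ * γ₃ + γ₁ * γ₂ * γ₄ + γ₁ * γ₃ * γ₄ + γ₂ * γ₃ * γ₄) = 0 := by
    linear_combination key
  rcases mul_eq_zero.1 hP3 with h | h
  · exact absurd h (pow_ne_zero 3 hP0)
  · exact h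

/-! ### §5 THE RANK-4 CLASS TEST: purity and `N`-positivity force the Weil charge to vanish -/

/-- **Class-test no-go for rank-4 split (or nef-filtered) designs at a tensor point — kernel version of (G) for
`e = 4`.** Let `l_j = α_j N + β_j L + β̄_j L̄` (`j = 1..4`) with `α_j > 0` and `β_j = u_j + i v_j`. The mixed
coefficients of `e₃(l₁, …, l₄)` are (DICTIONARY (P), verified numerically against the full expansion in
`b2b-hweil-pv2-g6/SEED-K3.md` §2): `[N²L] = Σ_j β_j e₂(α_{≠j})` (`hN2L_re`, `hN2L_im`),
`[NL²] = Σ_j α_j e₂(β_{≠j})` (real part `hNL2_re`; the imaginary part is NOT needed),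
`[NLL̄] = 2 Σ_j α_j Σ_{i<k, i,k≠j} (u_iu_k + v_iv_k)` (`hNLLbar`),
`[L²L̄] = (3E_uuu + E_uvv) + i(E_uuv + 3E_vvv)` (`hL2Lbar_re`, `hL2Lbar_im`), and the charge is
`a = [L³] = e₃(β) = (E_uuu − E_uvv) + i(E_uuv − E_vvv)`, where `E_uuu = e₃(u)`, `E_vvv = e₃(v)`,
`E_uuv = Σ_{i<j<k}(u_iu_jv_k + u_iv_ju_k + v_iu_ju_k)`, `E_uvv` likewise. CONCLUSION: `a = 0`. Proof:
`[NLL̄]/4 ± Re[NL²]/2` are `Σ_j α_j e₂(u_{≠j})` and `Σ_j α_j e₂(v_{≠j})`; §4 for `(α, u)` and `(α, v)` (the directions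
`z = 1` and `z = i` of (G)) gives `e₃(u) = e₃(v) = 0`, and then `[L²L̄] = 0` gives `E_uvv = E_uuv = 0`. Hence NO
design of species (S) with `e = 4` — zero locus or degeneracy locus `D₁` of two sections of `⊕_{i≤4} L_i`, `L_i`
with sections — is a Bloch seed for a non-zero Weil class at a tensor point with `NS = NS_gen`.
[cite: Fulton1998, §14.4 Thm 14.4] [cite: Garding1959, Thm 2] [cite: Bloch1972Semiregularity, Introduction and §7] -/
theorem splitRankFour_classTest_uncharged
    (α₁ α₂ α₃ α₄ u₁ u₂ u₃ u₄ v₁ v₂ v₃ v₄ : ℝ)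
    (hα₁ : 0 < α₁) (hα₂ : 0 < α₂) (hα₃ : 0 < α₃) (hα₄ : 0 < α₄)
    (hN2L_re : u₁ * (α₂ * α₃ + α₂ * α₄ + α₃ * α₄) + u₂ * (α₁ * α₃ + α₁ * α₄ + α₃ * α₄)
      + u₃ * (α₁ * α₂ + α₁ * α₄ + α₂ * α₄) + u₄ * (α₁ * α₂ + α₁ * α₃ + α₂ * α₃) = 0)
    (hN2L_im : v₁ * (α₂ * α₃ + α₂ * α₄ + α₃ * α₄) + v₂ * (α₁ * α₃ + α₁ * α₄ + α₃ * α₄)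
      + v₃ * (α₁ * α₂ + α₁ * α₄ + α₂ * α₄) + v₄ * (α₁ * α₂ + α₁ * α₃ + α₂ * α₃) = 0)
    (hNL2_re : α₁ * ((u₂ * u₃ - v₂ * v₃) + (u₂ * u₄ - v₂ * v₄) + (u₃ * u₄ - v₃ * v₄))
      + α₂ * ((u₁ * u₃ - v₁ * v₃) + (u₁ * u₄ - v₁ * v₄) + (u₃ * u₄ - v₃ * v₄))
      + α₃ * ((u₁ * u₂ - v₁ * v₂) + (u₁ * u₄ - v₁ * v₄) + (u₂ * u₄ - v₂ * v₄))
      + α₄ * ((u₁ * u₂ - v₁ * v₂) + (u₁ * u₃ - v₁ * v₃) + (u₂ * u₃ - v₂ * v₃)) = 0)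
    (hNLLbar : 2 * (α₁ * ((u₂ * u₃ + v₂ * v₃) + (u₂ * u₄ + v₂ * v₄) + (u₃ * u₄ + v₃ * v₄))
      + α₂ * ((u₁ * u₃ + v₁ * v₃) + (u₁ * u₄ + v₁ * v₄) + (u₃ * u₄ + v₃ * v₄))
      + α₃ * ((u₁ * u₂ + v₁ * v₂) + (u₁ * u₄ + v₁ * v₄) + (u₂ * u₄ + v₂ * v₄))
      + α₄ * ((u₁ * u₂ + v₁ * v₂) + (u₁ * u₃ + v₁ * v₃) + (u₂ * u₃ + v₂ * v₃))) = 0)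
    (hL2Lbar_re : 3 * (u₁ * u₂ * u₃ + u₁ * u₂ * u₄ + u₁ * u₃ * u₄ + u₂ * u₃ * u₄)
      + ((u₁ * v₂ * v₃ + v₁ * u₂ * v₃ + v₁ * v₂ * u₃) + (u₁ * v₂ * v₄ + v₁ * u₂ * v₄ + v₁ * v₂ * u₄)
        + (u₁ * v₃ * v₄ + v₁ * u₃ * v₄ + v₁ * v₃ * u₄)
        + (u₂ * v₃ * v₄ + v₂ * u₃ * v₄ + v₂ * v₃ * u₄)) = 0)
    (hL2Lbar_im : ((u₁ * u₂ * v₃ + u₁ * v₂ * u₃ + v₁ * u₂ * u₃)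
        + (u₁ * u₂ * v₄ + u₁ * v₂ * u₄ + v₁ * u₂ * u₄) + (u₁ * u₃ * v₄ + u₁ * v₃ * u₄ + v₁ * u₃ * u₄)
        + (u₂ * u₃ * v₄ + u₂ * v₃ * u₄ + v₂ * u₃ * u₄))
      + 3 * (v₁ * v₂ * v₃ + v₁ * v₂ * v₄ + v₁ * v₃ * v₄ + v₂ * v₃ * v₄) = 0) :
    (u₁ * u₂ * u₃ + u₁ * u₂ * u₄ + u₁ * u₃ * u₄ + u₂ * u₃ * u₄)
      - ((u₁ * v₂ * v₃ + v₁ * u₂ * v₃ + v₁ * v₂ * u₃) + (u₁ * v₂ * v₄ + v₁ * u₂ * v₄ + v₁ * v₂ * u₄)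
        + (u₁ * v₃ * v₄ + v₁ * u₃ * v₄ + v₁ * v₃ * u₄)
        + (u₂ * v₃ * v₄ + v₂ * u₃ * v₄ + v₂ * v₃ * u₄)) = 0 ∧
    ((u₁ * u₂ * v₃ + u₁ * v₂ * u₃ + v₁ * u₂ * u₃) + (u₁ * u₂ * v₄ + u₁ * v₂ * u₄ + v₁ * u₂ * u₄)
        + (u₁ * u₃ * v₄ + u₁ * v₃ * u₄ + v₁ * u₃ * u₄) + (u₂ * u₃ * v₄ + u₂ * v₃ * u₄ + v₂ * u₃ * u₄))
      - (v₁ * v₂ * v₃ + v₁ * v₂ * v₄ + v₁ * v₃ * v₄ + v₂ * v₃ * v₄) = 0 := by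
  -- the two `(α, γ)` systems of §4, for `γ = u` (direction `z = 1`) and `γ = v` (direction `z = i`)
  have huu : α₁ * (u₂ * u₃ + u₂ * u₄ + u₃ * u₄) + α₂ * (u₁ * u₃ + u₁ * u₄ + u₃ * u₄)
      + α₃ * (u₁ * u₂ + u₁ * u₄ + u₂ * u₄) + α₄ * (u₁ * u₂ + u₁ * u₃ + u₂ * u₃) = 0 := by
    linear_combination (1/4 : ℝ) * hNLLbar + (1/2 : ℝ) * hNL2_re
  have hvv : α₁ * (v₂ * v₃ + v₂ * v₄ + v₃ * v₄) + α₂ * (v₁ * v₃ + v₁ * v₄ + v₃ * v₄)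
      + α₃ * (v₁ * v₂ + v₁ * v₄ + v₂ * v₄) + α₄ * (v₁ * v₂ + v₁ * v₃ + v₂ * v₃) = 0 := by
    linear_combination (1/4 : ℝ) * hNLLbar - (1/2 : ℝ) * hNL2_re
  have hu := e3_eq_zero_of_adjacent_coeffs α₁ α₂ α₃ α₄ u₁ u₂ u₃ u₄ hα₁ hα₂ hα₃ hα₄ hN2L_re huu
  have hv := e3_eq_zero_of_adjacent_coeffs α₁ α₂ α₃ α₄ v₁ v₂ v₃ v₄ hα₁ hα₂ hα₃ hα₄ hN2L_im hvv
  constructor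
  · linear_combination 4 * hu - hL2Lbar_re
  · linear_combination (-4) * hv + hL2Lbar_im

/-! ### §6 The `(4,2)` determinantal class is a divided difference (the object of DICTIONARY (D)) -/

/-- **`c₃(E − F)` for `E = ⊕_{i≤4} L_i`, `F = M₁ ⊕ M₂` in twisted form.** With `X_i := l_i − m₂` and
`m := m₂ − m₁` (so `l_i − m₁ = X_i + m`), the degeneracy class
`c₃(E − F) = [u³] ∏(1 + l_iu)/((1 + m₁u)(1 + m₂u))` equals `e₃(X) + m·e₂(X) + m²·e₁(X) + m³`, and this times `m`
is `∏(X_i + m) − ∏ X_i`: the class is the divided difference `(∏(l_i − m₁) − ∏(l_i − m₂))/(m₂ − m₁)` of `e₄`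
— symmetric in `m₁ ↔ m₂`, invariant under twisting `E, F` by a line bundle, and (DICTIONARY (D)) not hyperbolic in
the positivity that ampleness of `Hom(F, E)` provides; the numerical class test for it is in `SEED-K3.md` §3.
[cite: Fulton1998, §14.4 Thm 14.4] -/
theorem detClass_four_two_dividedDifference {R : Type*} [CommRing R] (X₁ X₂ X₃ X₄ m : R) :
    ((X₁ * X₂ * X₃ + X₁ * X₂ * X₄ + X₁ * X₃ * X₄ + X₂ * X₃ * X₄)
      + m * (X₁ * X₂ + X₁ * X₃ + X₁ * X₄ + X₂ * X₃ + X₂ * X₄ + X₃ * X₄)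
      + m ^ 2 * (X₁ + X₂ + X₃ + X₄) + m ^ 3) * m
      = (X₁ + m) * (X₂ + m) * (X₃ + m) * (X₄ + m) - X₁ * X₂ * X₃ * X₄ := by
  ring

/-! ### §7 Appendix: the CM anchor, cubes — Cramer's rule on the blocks of a `(1,1)`-class -/

/-- **Cramer: if every column of `A`, put in place of any column of the invertible `B`, gives determinant zero, then
`A = 0`.** (`B.cramer a = 0` and `B *ᵥ B.cramer a = det B • a`.) DICTIONARY (M): `A`, `B` are the `(P, P̄)` and
`(P, Q̄')` blocks of a complex `(1,1)`-class `x` on `E_ι³ × E_ῑ³`; the hypothesis is the vanishing of the minors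
`det X_{123, {j,k',l'}}` forced by purity of `x³` with respect to a block-diagonal (`K`-compatible) `θ`, and
`det B ≠ 0` is the charge. [folklore] -/
theorem columns_eq_zero_of_mixed_minors {K : Type*} [Field K] {n : Type*} [Fintype n] [DecidableEq n]
    (A B : Matrix n n K) (hB : B.det ≠ 0)
    (h : ∀ i j, (B.updateCol j (fun r => A r i)).det = 0) : A = 0 := by
  ext r i
  have hc : B.cramer (fun r => A r i) = 0 := by
    funext j
    rw [Matrix.cramer_apply]
    exact h i j
  have hm := Matrix.mulVec_cramer B (fun r => A r i)
  rw [hc, Matrix.mulVec_zero] at hm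
  have := congr_fun hm r
  simp only [Pi.zero_apply, Pi.smul_apply, smul_eq_mul] at this
  rcases mul_eq_zero.1 this.symm with h1 | h1
  · exact absurd h1 hB
  · simpa using h1

/-- **No CUBE is pure and charged at the CM anchor** (kernel form of the crux dossier's "single cube impossible",
`Cruxes/WeilSixfoldsSqrtMinus7/Lines/semiregular-clean-lci-six-stub2-c12.md` §4 H2). In the notation of DICTIONARY (M):
if `det A = q·δ` with `δ = det T₁ ≠ 0` (the `(123,123)` purity condition), `det B = a ≠ 0` (the charge) and all the
mixed minors `det[A_{·i} → B_{·j}]` vanish (the `(123, {j,k',l'})` purity conditions), then `q = 0` — contradicting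
`∫_Z θ³ > 0` for an effective `Z`. Covers, for EVERY `K`-compatible polarization of the CM sixfold at once: complete
intersections of three divisors from one class, `c₃` of semi-homogeneous bundles (`c(E) = (1 + c₁/r)^r`), and any
design whose class is the cube of one complex `(1,1)`-class. General products `x·y·z` at the CM anchor are NOT covered
(numerics only: kit j022298 / j023470 of the dossier, Hermitian triples). [folklore] -/
theorem cmCube_classTest_uncharged {K : Type*} [Field K] {n : Type*} [Fintype n] [DecidableEq n] [Nonempty n]
    (A B : Matrix n n K) {q a δ : K} (hδ : δ ≠ 0) (ha : a ≠ 0)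
    (hA : A.det = q * δ) (hBdet : B.det = a)
    (h : ∀ i j, (B.updateCol j (fun r => A r i)).det = 0) : q = 0 := by
  have hB : B.det ≠ 0 := by rw [hBdet]; exact ha
  have hA0 : A = 0 := columns_eq_zero_of_mixed_minors A B hB h
  obtain ⟨i⟩ := ‹Nonempty n›
  have hdet : A.det = 0 := by
    rw [hA0]; exact Matrix.det_eq_zero_of_column_eq_zero i (fun _ => rfl)
  rw [hA] at hdet
  rcases mul_eq_zero.1 hdet with h1 | h1
  · exact h1
  · exact absurd h1 hδ

end Literature.AlgebraicGeometry.HodgeTheory.WeilClassTestSplitDesigns
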